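import Literature.Analysis.FluidPDE.ParabolicWeakMaxPointwise
import Summits.NavierStokesRegularity.FluidComputer.SwirlBarrierSpace
import Literature.Analysis.FluidPDE.SwirlMaximumPrincipleForced
import Literature.Analysis.FluidPDE.SelfSimilarLiouville
import HarnessLib

/-!
# Type-I inflow forces Type-I swirl: a parabolic barrier for `Γ = r u_θ` at an axis point

Cell `ns-blowup`, seat `ns-blowup-ecbridge-2` (g13; the E–C endpoint theory seat). Proof file
(NO definitions, no named facts, no `sorry`, no conjecture hypothesis). For a classical solution of
the FORCED axisymmetric Navier–Stokes system the swirl `Γ = r u_θ = x₀u₁ − x₁u₀` satisfies, off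
the axis, `∂ₜΓ + u·∇Γ = ν(ΔΓ − (2/r)∂ᵣΓ) + r f_θ` (Koch–Nadirashvili–Seregin–Šverák 2009 (1.8);
the tree's `swirl_transport_holds`, with the force), and `Γ = 0` on the axis; its maximum
principle gives `|Γ| ≤ sup|Γ₀| + t sup|r f_θ|` (`SwirlMaximumPrincipleForced.lean`). THIS FILE
proves a finer comparison at a point `c` OF THE AXIS under the one-component Type-I bound

  `|⟪x − c, u(t, x)⟫| ≤ C |x − c|/√(T − t)` on `[t₀, T'] × B(c, ρ₀)`, `T' < T`,

which is implied by the Type-I bound `|ū| ≤ C/√(T − t)` on the MERIDIONAL part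
`ū = u − u_θ e_θ` alone (`x − c` is a meridional vector). With `Ψ_a(s) = (1 − e^{−as})/a`,
`a = (C + 1)/ν`:

* **`exists_swirl_le_swirlBarrier`** — there are `K, A ≥ 0`, depending only on
  `ν, C, C_Γ, V₀, F₀, ρ₀, T − t₀`, such that for EVERY `T' ∈ (t₀, T)` and every classical forced
  solution on `[t₀, T'] × (EuclideanSpace ℝ (Fin 3))` with axisymmetric velocity and force, every axis point `c`, under
  the drift bound above, the swirl bound `|Γ| ≤ C_Γ` on `B̄(c, ρ₀)`, `|u(t₀, ·)| ≤ V₀` on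
  `B̄(c, ρ₀)` and `|f| ≤ F₀` on `B(c, ρ₀)`:
  `|Γ(t, x)| ≤ K Ψ_a(|x − c|/√(T − t)) + A |x − c|²/(T − t)` on `[t₀, T'] × B̄(c, ρ₀)`.

Since `Ψ_a(s) ≤ s` the barrier is LINEAR in `|x − c|` near `c`; centred at the foot of `x` on the
axis (`|x − foot| = r`) it yields `|u_θ| = |Γ|/r ≲ 1/√(T − t)` — Type-I SWIRL from Type-I
MERIDIONAL velocity (`SwirlTypeIBarrierMeridional.lean`), the quantitative content, for the rate
(1.1) of Seregin–Šverák 2009, of "oversimplifying slightly, we can replace `v̄` by `v` in our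
assumptions" (arXiv p. 4), obtained by comparison instead of the local energy method
(Lemma 3.5 / Prop. 3.7), and WITH a bounded force.

## The comparison

`weak_max_principle_of_contDiffAt` on `K = B̄(c, ρ₀)`, `U = B(c, ρ₀) ∖ {axis}` for
`w = σΓ − Φ`, `σ = ±1`, `Φ(t, x) = KΨ_a(μ|x − c|) + Aμ²|x − c|²`, `μ = 1/√(T − t)`. At a point of
`U` with `∇w = 0`, `Δw ≤ 0`: `σ∇Γ = ∇Φ = 2G'⟪x − c, ·⟫` and `σΔΓ ≤ ΔΦ = 4G''ρ² + 6G'`; because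
`c` is ON THE AXIS, `⟪x − c, e_r⟫ = r`, so the singular term `−ν(2/r)∂ᵣ(σΓ) = −4νG'` exactly
cancels the spherical part of `νΔΦ`; the drift costs `−2G'⟪x − c, u⟫ ≤ 2G'Cρμ`, the force
`σ r f_θ ≤ ρF₀` (`|r f_θ| ≤ r|f| ≤ ρF₀`); with `∂ₜΦ = Ke^{−aμρ}ρμ³/2 + Aμ⁴ρ²` everything
collapses (`swirlBarrier_interior_identity`) to
`μ²·[−Ke^{−as}(1 + s/2) + A(2ν + 2Cs − s²) + sF₀/μ³] ≤ 0` (`swirlBarrier_bracket_nonpos`,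
`s = μρ`, `A = (T − t₀)^{3/2}F₀`, `K ≥ e^{aS₀}AP₀`). Parabolic boundary: `Γ = 0 ≤ Φ` on the axis;
`|Γ| ≤ C_Γ ≤ Kμ₀ρ₀e^{−aμ₀ρ₀} ≤ Φ` on the sphere `|x − c| = ρ₀`; `|Γ(t₀)| ≤ r|u| ≤ ρV₀ ≤ Φ(t₀)`
(`swirlBarrier_sq_lower`, `exists_swirlBarrierK`).

## Tree search / literature

No comparison result of this kind in the tree; printed one-component criteria on the radial
velocity are of Serrin-integrability type (Neustupa–Pokorný 2000; Kubica–Pokorný–Zajączkowski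
arXiv:1003.3213: `L^q`-energy estimates for `u_θ`), which miss the non-integrable Type-I rate;
Seregin–Šverák 2009 treat the meridional hypothesis through Lemma 3.3 + the local energy
bootstrap. WHAT THIS IS NOT: not a statement about blow-up — an a priori comparison lemma for
classical forced axisymmetric solutions (consumer `ClayBlowupLocalMeridionalTypeI.lean`).

References: Koch–Nadirashvili–Seregin–Šverák, Acta Math. 203 (2009), §1 (1.8)–(1.9)
[cite: KochNadirashviliSereginSverak2009, §1 (1.8)–(1.9) (arXiv p. 2)]; Seregin–Šverák, Comm.
PDE 34 (2009) = arXiv:0804.1803, §1 (1.1)–(1.2), p. 4 [cite: SereginSverak2009, §1 (1.1) and p. 4];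
Lieberman 1996, Ch. II [cite: Lieberman1996, Ch. II Lemma 2.1 and Lemma 2.3].
-/

noncomputable section

open MeasureTheory Set Function Filter Topology Metric InnerProductSpace WithLp
open scoped RealInnerProductSpace Laplacian ContDiff NNReal
open Literature.Analysis Literature.Analysis.FluidPDE

namespace Summit.NavierStokesRegularity.FluidComputer

section Main

/-- **TYPE-I INFLOW FORCES TYPE-I SWIRL — the barrier at an axis point** (see the module
docstring; constants `K, A ≥ 0` depend on `ν, C, C_Γ, V₀, F₀, ρ₀, T − t₀` only, NOT on `T'` nor
on the solution). [cite: KochNadirashviliSereginSverak2009, §1 (1.8)–(1.9) (arXiv p. 2)] -/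
theorem exists_swirl_le_swirlBarrier {T t₀ ν C CΓ V₀ F₀ ρ₀ : ℝ} (hν : 0 < ν) (ht₀T : t₀ < T)
    (hC : 0 ≤ C) (hCΓ : 0 ≤ CΓ) (hV₀ : 0 ≤ V₀) (hF₀ : 0 ≤ F₀) (hρ₀ : 0 < ρ₀) :
    ∃ K A : ℝ, 0 ≤ K ∧ 0 ≤ A ∧
      ∀ (T' : ℝ) (v f : ℝ → (EuclideanSpace ℝ (Fin 3)) → (EuclideanSpace ℝ (Fin 3))) (q : ℝ → (EuclideanSpace ℝ (Fin 3)) → ℝ) (c : (EuclideanSpace ℝ (Fin 3))), t₀ < T' → T' < T →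
        IsClassicalNSSolutionOn (Icc t₀ T') ν f v q →
        (∀ t ∈ Icc t₀ T', IsAxisymmetric (v t)) → (∀ t ∈ Icc t₀ T', IsAxisymmetric (f t)) →
        cylRadius c = 0 →
        (∀ t ∈ Icc t₀ T', ∀ x ∈ ball c ρ₀,
          |⟪x - c, v t x⟫| ≤ C * ‖x - c‖ / Real.sqrt (T - t)) →
        (∀ t ∈ Icc t₀ T', ∀ x ∈ closedBall c ρ₀, |swirl (v t) x| ≤ CΓ) →
        (∀ x ∈ closedBall c ρ₀, ‖v t₀ x‖ ≤ V₀) →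
        (∀ t ∈ Icc t₀ T', ∀ x ∈ ball c ρ₀, ‖f t x‖ ≤ F₀) →
        ∀ t ∈ Icc t₀ T', ∀ x ∈ closedBall c ρ₀,
          |swirl (v t) x| ≤
            K * ((1 - Real.exp (-((C + 1) / ν * (‖x - c‖ / Real.sqrt (T - t))))) /
                ((C + 1) / ν)) +
              A * ‖x - c‖ ^ 2 / (T - t) := by
  -- ### constants
  set D : ℝ := T - t₀ with hD
  have hD0 : 0 < D := by rw [hD]; linarith
  have hsD : 0 < Real.sqrt D := Real.sqrt_pos.2 hD0
  set a : ℝ := (C + 1) / ν with ha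
  have ha0 : 0 < a := by rw [ha]; positivity
  set A : ℝ := D * Real.sqrt D * F₀ with hA
  have hA0 : 0 ≤ A := by rw [hA]; positivity
  obtain ⟨K, hK0, hK1, hKV, hKΓ⟩ := exists_swirlBarrierK hν hC hCΓ hV₀ hF₀ hρ₀ hD0
  rw [← ha] at hKV hKΓ
  refine ⟨K, A, hK0, hA0, ?_⟩
  intro T' v f q c ht₀ hT' hcl haxi hfaxi hc hdrift hΓ hV₀b hF₀b
  -- ### the similarity scale
  have hμt : ∀ t ∈ Icc t₀ T', 0 < (Real.sqrt (T - t))⁻¹ := fun t ht =>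
    invSqrtGap_pos (ht.2.trans_lt hT')
  have hμmono : ∀ t ∈ Icc t₀ T', (Real.sqrt D)⁻¹ ≤ (Real.sqrt (T - t))⁻¹ := fun t ht =>
    invSqrtGap_mono ht.1 (ht.2.trans_lt hT')
  have ht₀I : t₀ ∈ Icc t₀ T' := ⟨le_rfl, ht₀.le⟩
  -- ### reduction to the two one-sided statements
  set Φ : ℝ → (EuclideanSpace ℝ (Fin 3)) → ℝ := fun t x =>
    K * ((1 - Real.exp (-(a * ((Real.sqrt (T - t))⁻¹ * Real.sqrt (‖x - c‖ ^ 2))))) / a) +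
      A * (Real.sqrt (T - t))⁻¹ ^ 2 * ‖x - c‖ ^ 2 with hΦ
  have hΦeq : ∀ t ∈ Icc t₀ T', ∀ x, Φ t x =
      K * ((1 - Real.exp (-(a * (‖x - c‖ / Real.sqrt (T - t))))) / a) +
        A * ‖x - c‖ ^ 2 / (T - t) := by
    intro t ht x
    have hgap : 0 < T - t := by linarith [ht.2]
    simp only [hΦ, Real.sqrt_sq (norm_nonneg _), inv_pow, Real.sq_sqrt hgap.le]
    rw [inv_mul_eq_div]
    ring
  suffices key : ∀ σ : ℝ, (σ = 1 ∨ σ = -1) →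
      ∀ t ∈ Icc t₀ T', ∀ x ∈ closedBall c ρ₀, σ * swirl (v t) x - Φ t x ≤ 0 by
    intro t ht x hx
    rw [← hΦeq t ht x]
    have h1 := key 1 (Or.inl rfl) t ht x hx
    have h2 := key (-1) (Or.inr rfl) t ht x hx
    rw [one_mul] at h1
    rw [neg_one_mul] at h2
    exact abs_le.2 ⟨by linarith, by linarith⟩
  intro σ hσ
  have hσabs : ∀ b : ℝ, σ * b ≤ |b| := fun b => by
    rcases hσ with h | h
    · rw [h, one_mul]; exact le_abs_self b
    · rw [h, neg_one_mul]; exact neg_le_abs b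
  -- ### Φ ≥ 0 and Φ ≥ K μ₀ |x − c| e^{−a μ₀ ρ₀} on `[t₀, T'] × B̄(c, ρ₀)`
  have hΦlow : ∀ t ∈ Icc t₀ T', ∀ x ∈ closedBall c ρ₀,
      K * ((Real.sqrt D)⁻¹ * ‖x - c‖ * Real.exp (-(a * ((Real.sqrt D)⁻¹ * ρ₀)))) ≤ Φ t x ∧
        0 ≤ Φ t x := fun t ht x hx =>
    swirlBarrier_sq_lower hK0 hA0 ha0 (inv_nonneg.2 hsD.le) (hμmono t ht) (norm_nonneg _)
      (mem_closedBall_iff_norm.1 hx)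
  -- ### the pressure is axisymmetric: the swirl equation holds off the axis
  have hp : ∀ t ∈ Icc t₀ T', IsAxisymmetricScalar (q t) := fun t ht =>
    hcl.isAxisymmetricScalar_pressure (uniqueDiffOn_Icc ht₀) haxi hfaxi ht
  -- ### the comparison function
  set w : ℝ → (EuclideanSpace ℝ (Fin 3)) → ℝ := fun t x => σ * swirl (v t) x - Φ t x with hw
  set Γₜ : ℝ → (EuclideanSpace ℝ (Fin 3)) → ℝ := fun t x =>
    timeDerivWithin (Icc t₀ T') (fun s => swirl (v s)) t x with hΓₜ
  set Φₜ : ℝ → (EuclideanSpace ℝ (Fin 3)) → ℝ := fun t x =>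
    K * Real.exp (-(a * ((Real.sqrt (T - t))⁻¹ * ‖x - c‖))) * ‖x - c‖ *
        (Real.sqrt (T - t))⁻¹ ^ 3 / 2 +
      A * (Real.sqrt (T - t))⁻¹ ^ 4 * ‖x - c‖ ^ 2 with hΦₜ
  set wₜ : ℝ → (EuclideanSpace ℝ (Fin 3)) → ℝ := fun t x => σ * Γₜ t x - Φₜ t x with hwₜ
  set Kset : Set (EuclideanSpace ℝ (Fin 3)) := closedBall c ρ₀ with hKset
  set U : Set (EuclideanSpace ℝ (Fin 3)) := ball c ρ₀ ∩ {x | cylRadius x ≠ 0} with hU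
  have hKc : IsCompact Kset := isCompact_closedBall _ _
  have hUo : IsOpen U := isOpen_ball.inter (isOpen_ne_fun continuous_cylRadius continuous_const)
  have hUK : U ⊆ Kset := fun x hx => ball_subset_closedBall hx.1
  have hUc : ∀ x ∈ U, x ≠ c := fun x hx h => hx.2 (by rw [h]; exact hc)
  -- regularity of the velocity
  have hsm := hcl.smooth_velocity
  have hvC2 : ∀ t ∈ Icc t₀ T', ContDiff ℝ 2 (v t) := fun t ht =>
    (hcl.contDiff_velocity ht).of_le (by norm_cast)
  have hvd : ∀ t ∈ Icc t₀ T', ∀ x, DifferentiableAt ℝ (v t) x := fun t ht x =>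
    ((hvC2 t ht).of_le one_le_two).differentiable one_ne_zero x
  -- (a) joint continuity
  have hcont : ContinuousOn (uncurry w) (Icc t₀ T' ×ˢ Kset) := by
    have hvc : ContinuousOn (uncurry v) (Icc t₀ T' ×ˢ Kset) :=
      hsm.continuousOn.mono (prod_mono Subset.rfl (subset_univ _))
    have h1 : ContinuousOn (fun p : ℝ × (EuclideanSpace ℝ (Fin 3)) => ⟪rotGenL p.2, uncurry v p⟫) (Icc t₀ T' ×ˢ Kset) :=
      (rotGenL.continuous.comp continuous_snd).continuousOn.inner hvc
    have h2 : ContinuousOn (fun p : ℝ × (EuclideanSpace ℝ (Fin 3)) => Φ p.1 p.2) (Icc t₀ T' ×ˢ Kset) :=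
      continuousOn_swirlBarrier_gap K A a T c (fun t ht => ht.2.trans_lt hT') Kset
    refine (((continuousOn_const (c := σ)).mul h1).sub h2).congr fun p _ => ?_
    simp only [hw, uncurry, rotGenL_apply, swirl_eq_inner_rotGen, Pi.sub_apply, Pi.mul_apply]
  -- (b) `C²` slices at the points of `U`
  have h2 : ∀ t ∈ Ioc t₀ T', ∀ x ∈ U, ContDiffAt ℝ 2 (w t) x := by
    intro t ht x hx
    have htI : t ∈ Icc t₀ T' := ⟨ht.1.le, ht.2⟩
    exact ((contDiff_const.mul (contDiff_swirl (hvC2 t htI))).contDiffAt).sub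
      (contDiffAt_swirlBarrier (hUc x hx))
  -- (c) the left time derivative
  have htime : ∀ t ∈ Ioc t₀ T', ∀ x ∈ U,
      HasDerivWithinAt (fun s => w s x) (wₜ t x) (Icc t₀ t) t := by
    intro t ht x _
    have htI : t ∈ Icc t₀ T' := ⟨ht.1.le, ht.2⟩
    have hΓ' : HasDerivWithinAt (fun s => swirl (v s) x) (Γₜ t x) (Icc t₀ T') t := by
      have hd : DifferentiableWithinAt ℝ (fun s => swirl (v s) x) (Icc t₀ T') t := by
        have h1 := hsm.differentiableWithinAt_time htI x
        simp only [swirl_eq_inner_rotGen]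
        exact (differentiableWithinAt_const _).inner ℝ h1
      have := hd.hasDerivWithinAt
      simp only [hΓₜ, timeDerivWithin_apply]
      exact this
    have hΦ' : HasDerivAt (fun s => Φ s x) (Φₜ t x) t := by
      have h := hasDerivAt_swirlBarrier_time (K := K) (A := A) (ρ := ‖x - c‖) ha0.ne'
        (htI.2.trans_lt hT') (norm_nonneg _)
      simp only [hΦ, hΦₜ]
      exact h
    have h := ((hΓ'.const_mul σ).sub hΦ'.hasDerivWithinAt).mono (Icc_subset_Icc_right ht.2)
    simp only [hw, hwₜ]
    exact h
  -- (d) the interior inequality at a critical point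
  have hsub : ∀ t ∈ Ioc t₀ T', ∀ x ∈ U, fderiv ℝ (w t) x = 0 → (Δ (w t)) x ≤ 0 → wₜ t x ≤ 0 := by
    intro t ht x hx hgrad hlap
    have htI : t ∈ Icc t₀ T' := ⟨ht.1.le, ht.2⟩
    have hr : cylRadius x ≠ 0 := hx.2
    have hxc : x ≠ c := hUc x hx
    have hρ0 : 0 < ‖x - c‖ := norm_pos_iff.2 (sub_ne_zero.2 hxc)
    set ρ : ℝ := ‖x - c‖ with hρ
    set μ : ℝ := (Real.sqrt (T - t))⁻¹ with hμdef
    have hμ0 : 0 < μ := hμt t htI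
    set e : ℝ := Real.exp (-(a * (μ * ρ))) with he
    have hsqρ : Real.sqrt (ρ ^ 2) = ρ := Real.sqrt_sq hρ0.le
    have hσpos : 0 < ρ ^ 2 := by positivity
    -- the two derivative values of Φ
    set g₁ : ℝ := K * (Real.exp (-(a * (μ * Real.sqrt (ρ ^ 2)))) * (μ / (2 * Real.sqrt (ρ ^ 2)))) +
      A * μ ^ 2 with hg₁
    have hg₁v : g₁ = (K * μ * e / ρ + 2 * A * μ ^ 2) / 2 := by
      have := two_mul_swirlBarrierSq₁_sq K A a μ hρ0
      rw [hg₁, he]; linarith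
    have hg₁0 : 0 ≤ g₁ := by rw [hg₁v]; positivity
    have hlapv : 4 * (-(K * μ / 4) * Real.exp (-(a * (μ * Real.sqrt (ρ ^ 2)))) *
          (a * μ / ρ ^ 2 + 1 / (ρ ^ 2 * Real.sqrt (ρ ^ 2)))) * ρ ^ 2 + 6 * g₁ =
        -(K * a * μ ^ 2 * e) + 2 * K * μ * e / ρ + 6 * A * μ ^ 2 :=
      laplacian_value_swirlBarrierSq K A a μ hρ0
    -- the swirl equation at `(t, x)`, with the force
    have hpde := swirl_transport_holds hcl haxi hp htI hr
    rw [convect_apply, partialDeriv_apply] at hpde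
    -- gradient condition: `σ ∇Γ = ∇Φ = 2 g₁ ⟪x − c, ·⟫`
    have hΓd : DifferentiableAt ℝ (swirl (v t)) x := differentiableAt_swirl (hvd t htI x)
    have hΦd : HasFDerivAt (Φ t) ((2 * g₁) • (innerSL ℝ (x - c) : (EuclideanSpace ℝ (Fin 3)) →L[ℝ] ℝ)) x := by
      have h := hasFDerivAt_comp_norm_sub_sq (c := c) (x := x)
        (hasDerivAt_swirlBarrierSq K A μ ha0.ne' hσpos)
      simp only [hΦ, hg₁, hρ, hμdef]
      exact h
    have hwderiv : HasFDerivAt (w t) (σ • fderiv ℝ (swirl (v t)) x -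
        (2 * g₁) • (innerSL ℝ (x - c) : (EuclideanSpace ℝ (Fin 3)) →L[ℝ] ℝ)) x := by
      have h := (hΓd.hasFDerivAt.const_mul σ).sub hΦd
      simp only [hw]
      exact h
    have hDeq : σ • fderiv ℝ (swirl (v t)) x = (2 * g₁) • (innerSL ℝ (x - c) : (EuclideanSpace ℝ (Fin 3)) →L[ℝ] ℝ) := by
      have := hwderiv.fderiv
      rw [hgrad] at this
      exact (sub_eq_zero.1 this.symm)
    have hDapply : ∀ h : (EuclideanSpace ℝ (Fin 3)), σ * fderiv ℝ (swirl (v t)) x h = 2 * g₁ * ⟪x - c, h⟫ := fun h => by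
      have := congrArg (fun L : (EuclideanSpace ℝ (Fin 3)) →L[ℝ] ℝ => L h) hDeq
      simpa only [smul_apply, innerSL_apply_apply, smul_eq_mul] using this
    -- Laplacian condition: `σ ΔΓ ≤ ΔΦ`
    have hΦlap : (Δ (Φ t)) x =
        4 * (-(K * μ / 4) * Real.exp (-(a * (μ * Real.sqrt (ρ ^ 2)))) *
          (a * μ / ρ ^ 2 + 1 / (ρ ^ 2 * Real.sqrt (ρ ^ 2)))) * ρ ^ 2 + 6 * g₁ := by
      have h := laplacian_comp_norm_sub_sq (c := c) (x := x) isOpen_Ioi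
        (fun σ hσ => hasDerivAt_swirlBarrierSq K A μ ha0.ne' hσ) hσpos
        (hasDerivAt_swirlBarrierSq₁ K A a μ hσpos)
      simp only [hΦ, hg₁, hρ, hμdef]
      exact h
    have hΔeq : (Δ (w t)) x = σ * (Δ (swirl (v t))) x - (Δ (Φ t)) x := by
      have h1 : ContDiffAt ℝ 2 (fun y => σ * swirl (v t) y) x :=
        (contDiff_const.mul (contDiff_swirl (hvC2 t htI))).contDiffAt
      have h2' : ContDiffAt ℝ 2 (Φ t) x := contDiffAt_swirlBarrier (hUc x hx)
      have h3 : (Δ (fun y => σ * swirl (v t) y)) x = σ * (Δ (swirl (v t))) x := by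
        have : (fun y => σ * swirl (v t) y) = σ • swirl (v t) := by
          funext y; simp [smul_eq_mul]
        rw [this, laplacian_smul σ ((contDiff_swirl (hvC2 t htI)).contDiffAt), smul_eq_mul]
      have h4 := h1.laplacian_sub h2'
      have hfun : w t = (fun y => σ * swirl (v t) y) - Φ t := by
        funext y; simp only [hw, Pi.sub_apply]
      rw [hfun, h4, h3]
    have hΔ : σ * (Δ (swirl (v t))) x ≤
        4 * (-(K * μ / 4) * Real.exp (-(a * (μ * Real.sqrt (ρ ^ 2)))) *
          (a * μ / ρ ^ 2 + 1 / (ρ ^ 2 * Real.sqrt (ρ ^ 2)))) * ρ ^ 2 + 6 * g₁ := by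
      rw [hΔeq, hΦlap] at hlap; linarith
    -- the singular drift term: `⟪x − c, e_r⟫ = r`
    have hrad : σ * fderiv ℝ (swirl (v t)) x (eR x) = 2 * g₁ * cylRadius x := by
      rw [hDapply, inner_sub_axisPoint_eR hc]
    -- the Type-I drift term
    have hconv : -(σ * fderiv ℝ (swirl (v t)) x (v t x)) ≤ 2 * g₁ * (C * ρ * μ) := by
      rw [hDapply]
      have h1 := hdrift t htI x hx.1
      have h2 : C * ‖x - c‖ / Real.sqrt (T - t) = C * ρ * μ := by
        rw [hρ, hμdef, div_eq_mul_inv]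
      rw [h2] at h1
      have h3 : -⟪x - c, v t x⟫ ≤ C * ρ * μ := by linarith [(abs_le.1 h1).1]
      calc -(2 * g₁ * ⟪x - c, v t x⟫) = 2 * g₁ * (-⟪x - c, v t x⟫) := by ring
        _ ≤ 2 * g₁ * (C * ρ * μ) := mul_le_mul_of_nonneg_left h3 (by positivity)
    -- the force term
    have hforce : σ * swirl (f t) x ≤ ρ * F₀ := by
      refine (hσabs _).trans ?_
      calc |swirl (f t) x| ≤ cylRadius x * ‖f t x‖ := abs_swirl_le_cylRadius_mul_norm (f t) x
        _ ≤ ρ * F₀ := mul_le_mul (cylRadius_le_norm_sub_axisPoint hc x) (hF₀b t htI x hx.1)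
            (norm_nonneg _) hρ0.le
    -- assemble `σ Γₜ`
    have hΓeq : Γₜ t x = ν * ((Δ (swirl (v t))) x -
        2 / cylRadius x * fderiv ℝ (swirl (v t)) x (eR x)) -
        fderiv ℝ (swirl (v t)) x (v t x) + swirl (f t) x := by
      have := eq_sub_of_add_eq hpde
      simp only [hΓₜ]
      rw [this]
      ring
    have hΓt : σ * Γₜ t x ≤
        ν * (4 * (-(K * μ / 4) * Real.exp (-(a * (μ * Real.sqrt (ρ ^ 2)))) *
          (a * μ / ρ ^ 2 + 1 / (ρ ^ 2 * Real.sqrt (ρ ^ 2)))) * ρ ^ 2 + 6 * g₁) -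
        4 * ν * g₁ + 2 * g₁ * (C * ρ * μ) + ρ * F₀ := by
      have e1 : σ * Γₜ t x = ν * (σ * (Δ (swirl (v t))) x) -
          ν * (2 / cylRadius x) * (σ * fderiv ℝ (swirl (v t)) x (eR x)) -
          σ * fderiv ℝ (swirl (v t)) x (v t x) + σ * swirl (f t) x := by
        rw [hΓeq]; ring
      rw [e1, hrad]
      have e2 : ν * (2 / cylRadius x) * (2 * g₁ * cylRadius x) = 4 * ν * g₁ := by
        field_simp
        ring
      rw [e2]
      have h1 := mul_le_mul_of_nonneg_left hΔ hν.le
      linarith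
    -- the supersolution inequality in the similarity variable `s = μ ρ`
    have hμτ : 1 ≤ D * Real.sqrt D * μ ^ 3 :=
      one_le_gap_mul_invSqrtGap_pow htI.1 (htI.2.trans_lt hT')
    have hbr := swirlBarrier_bracket_nonpos (K := K) (s := μ * ρ) hν hC hF₀
      (by positivity : 0 ≤ D * Real.sqrt D) hμ0 hμτ (by positivity) hK0 hK1
    have hid := swirlBarrier_interior_identity (K := K) (A := A) (e := e) (F₀ := F₀) (C := C)
      hν.ne' hρ0.ne' hμ0.ne'
    have e3 : wₜ t x = σ * Γₜ t x - (K * e * ρ * μ ^ 3 / 2 + A * μ ^ 4 * ρ ^ 2) := by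
      simp only [hwₜ, hΦₜ, he, hρ, hμdef]
    rw [e3]
    have h5 : ν * (4 * (-(K * μ / 4) * Real.exp (-(a * (μ * Real.sqrt (ρ ^ 2)))) *
          (a * μ / ρ ^ 2 + 1 / (ρ ^ 2 * Real.sqrt (ρ ^ 2)))) * ρ ^ 2 + 6 * g₁) - 4 * ν * g₁ +
        2 * g₁ * (C * ρ * μ) + ρ * F₀ - (K * e * ρ * μ ^ 3 / 2 + A * μ ^ 4 * ρ ^ 2) ≤ 0 := by
      rw [hlapv, hg₁v, ha, hid, hA]
      have : Real.exp (-((C + 1) / ν * (μ * ρ))) = e := by rw [he, ha]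
      rw [this] at hbr
      exact mul_nonpos_iff.2 (Or.inl ⟨by positivity, hbr⟩)
    linarith
  -- (e) the parabolic boundary: `t = t₀`, where `|Γ| ≤ r V₀ ≤ |x − c| V₀`
  have hbot : ∀ x ∈ Kset, w t₀ x ≤ 0 := by
    intro x hx
    obtain ⟨hlow, -⟩ := hΦlow t₀ ht₀I x hx
    have h1 : σ * swirl (v t₀) x ≤ ‖x - c‖ * V₀ := by
      refine (hσabs _).trans ?_
      calc |swirl (v t₀) x| ≤ cylRadius x * ‖v t₀ x‖ := abs_swirl_le_cylRadius_mul_norm (v t₀) x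
        _ ≤ ‖x - c‖ * V₀ := mul_le_mul (cylRadius_le_norm_sub_axisPoint hc x) (hV₀b x hx)
            (norm_nonneg _) (norm_nonneg _)
    have h2 : ‖x - c‖ * V₀ ≤
        K * ((Real.sqrt D)⁻¹ * ‖x - c‖ * Real.exp (-(a * ((Real.sqrt D)⁻¹ * ρ₀)))) := by
      have := mul_le_mul_of_nonneg_left hKV (norm_nonneg (x - c))
      linarith [this]
    simp only [hw]
    linarith
  -- (f) the parabolic boundary: the axis (`Γ = 0`) and the sphere (`|Γ| ≤ C_Γ`)
  have hlat : ∀ t ∈ Icc t₀ T', ∀ x ∈ Kset \ U, w t x ≤ 0 := by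
    intro t ht x hx
    obtain ⟨hlow, hΦ0⟩ := hΦlow t ht x hx.1
    simp only [hw]
    by_cases hax : cylRadius x = 0
    · rw [swirl_eq_zero_of_cylRadius_eq_zero (v t) hax, mul_zero]
      linarith
    · have hxρ : ‖x - c‖ = ρ₀ := by
        have hle : ‖x - c‖ ≤ ρ₀ := mem_closedBall_iff_norm.1 hx.1
        have hnot : x ∉ ball c ρ₀ := fun hb => hx.2 ⟨hb, hax⟩
        have hge : ρ₀ ≤ ‖x - c‖ := by
          rw [mem_ball_iff_norm, not_lt] at hnot; exact hnot
        exact le_antisymm hle hge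
      have h1 : σ * swirl (v t) x ≤ CΓ := (hσabs _).trans (hΓ t ht x hx.1)
      rw [hxρ] at hlow
      linarith
  intro t ht x hx
  exact weak_max_principle_of_contDiffAt hKc hUo hUK hcont h2 htime hsub hbot hlat t ht x hx

end Main

end Summit.NavierStokesRegularity.FluidComputer

end
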